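import Summits.AtomisticToContinuum.Crystallization.Theorems.ThreeConeCertificateKeplerBound
import Summits.AtomisticToContinuum.Crystallization.Theses.BraggSlacknessRigidity
import Summits.AtomisticToContinuum.Crystallization.Theses.ExcessDecayLiouville

/-!
# `KeplerBound` (stmt-AtomisticToContinuum-11961) is item 0627 `CrysPeriodicMinAttained` by name

Support file for the shared support item `KeplerBound` of routes `ThreeConeCertificate` and
`BraggSlacknessRigidity` (stmt-AtomisticToContinuum-11961):

`∃ P periodic, ∀ N, ∀ x : Fin N → ℝ³ injective, N · e_LJ(P) ≤ E_LJ(x)`.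

`ThreeConeCertificateKeplerBound.lean` certified that the item is the attainment of the periodic
infimum `e* = ⨅_Q e_LJ(Q)` of the Lennard-Jones energy per particle over periodic configurations of
`ℝ³` (`keplerBound_iff_exists_isLeast`), i.e. conjunct (i) `HasPeriodicGroundStateEnergy
lennardJones 3` of the sub-problem.  That attainment statement is itself a filed item, shared by
nineteen routes of the board: `CrysPeriodicMinAttained` (stmt-AtomisticToContinuum-0627, decl
`ExcessDecayLiouville.CrysPeriodicMinAttained` and verbatim twins).  Here the identification is
recorded BY NAME, so that whichever of the two items is settled first closes the other in one line:

* `keplerBound_iff_crysPeriodicMinAttained` — item 11961 `↔` item 0627;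
* `keplerBound_of_crysPeriodicMinAttained`, `crysPeriodicMinAttained_of_keplerBound` — the two
  directions as implications;
* `hasPeriodicGroundStateEnergy_iff_crysPeriodicMinAttained` — conjunct (i) `↔` item 0627 (the
  convergence `E(N)/N → e(P)` in conjunct (i) is automatic: `E(N)/N → e*` unconditionally,
  `ChargedEnergyGapNegative.crysEnergyLimit`);
* `braggSlacknessRigidity_keplerBound_iff` — the `BraggSlacknessRigidity` twin decl of the item is
  the same proposition (`Iff.rfl`), whence `braggSlacknessRigidity_keplerBound_iff_crysPeriodicMinAttained`.

Nothing here closes the item: attainment of the periodic infimum for Lennard-Jones in `ℝ³` is the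
energetic half of the crystallization conjecture (Blanc–Lewin 2015, §2.3, "completely open in
dimension three").
-/

noncomputable section

namespace Summit.AtomisticToContinuum.Crystallization.Theorems

open Literature.MathematicalPhysics.StatisticalMechanics
open Summit.AtomisticToContinuum.Crystallization.Theses

/-- **Item 11961 `↔` item 0627**: the Kepler bound for Lennard-Jones holds iff the infimum of the
Lennard-Jones energy per particle over periodic configurations of `ℝ³` is attained
(`keplerBound_iff_exists_isLeast`, restated against the filed decl
`ExcessDecayLiouville.CrysPeriodicMinAttained`). [folklore] -/
theorem keplerBound_iff_crysPeriodicMinAttained :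
    ThreeConeCertificate.KeplerBound ↔ ExcessDecayLiouville.CrysPeriodicMinAttained :=
  keplerBound_iff_exists_isLeast

/-- A periodic minimiser of the Lennard-Jones energy per particle (item 0627) gives the Kepler
bound (item 11961). [folklore] -/
theorem keplerBound_of_crysPeriodicMinAttained (h : ExcessDecayLiouville.CrysPeriodicMinAttained) :
    ThreeConeCertificate.KeplerBound :=
  keplerBound_iff_crysPeriodicMinAttained.2 h

/-- The Kepler bound (item 11961) gives a periodic minimiser of the Lennard-Jones energy per
particle (item 0627). [folklore] -/
theorem crysPeriodicMinAttained_of_keplerBound (h : ThreeConeCertificate.KeplerBound) :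
    ExcessDecayLiouville.CrysPeriodicMinAttained :=
  keplerBound_iff_crysPeriodicMinAttained.1 h

/-- **Conjunct (i) `↔` item 0627**: `HasPeriodicGroundStateEnergy lennardJones 3` iff the periodic
infimum is attained — the convergence `E(N)/N → e(P)` required by conjunct (i) is automatic, since
`E(N)/N → e*` unconditionally (`ChargedEnergyGapNegative.crysEnergyLimit`, through
`keplerBound_iff_hasPeriodicGroundStateEnergy`). [folklore] -/
theorem hasPeriodicGroundStateEnergy_iff_crysPeriodicMinAttained :
    HasPeriodicGroundStateEnergy lennardJones 3 ↔ ExcessDecayLiouville.CrysPeriodicMinAttained :=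
  keplerBound_iff_hasPeriodicGroundStateEnergy.symm.trans keplerBound_iff_crysPeriodicMinAttained

/-- The `BraggSlacknessRigidity` decl of the shared item 11961 is the same proposition as the
`ThreeConeCertificate` decl. [folklore] -/
theorem braggSlacknessRigidity_keplerBound_iff :
    BraggSlacknessRigidity.KeplerBound ↔ ThreeConeCertificate.KeplerBound :=
  Iff.rfl

/-- Hence the `BraggSlacknessRigidity` twin of item 11961 is also item 0627. [folklore] -/
theorem braggSlacknessRigidity_keplerBound_iff_crysPeriodicMinAttained :
    BraggSlacknessRigidity.KeplerBound ↔ ExcessDecayLiouville.CrysPeriodicMinAttained :=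
  keplerBound_iff_crysPeriodicMinAttained

end Summit.AtomisticToContinuum.Crystallization.Theorems

end
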